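import Summits.Ventures.HodgeRepro2.A2PlaneMonomials

/-!
# Powers of the dual Lefschetz operator of the model (A2 annex, operator identity — part 2)

The plane contractions `Λ_p = ι_{b_p^*} ∘ ι_{a_p^*}` of `A2HardLefschetzOps` commute pairwise and
are square-zero, so they generate a **commutative** subalgebra `lamAlg` of `End(A ι)`, in which p5's
multinomial identity `sum_pow_of_sq_eq_zero` applies: for `Λ = Σ_p c_p⁻¹ Λ_p` (row 101's `lam c`),

  `Λ^m = m! · Σ_{|T| = m} (∏_{p ∈ T} c_p⁻¹) Λ_T`,  `Λ_T = ∏_{p ∈ T} Λ_p`  (`lam_pow_eq`),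

and on a plane-sorted monomial `Λ_T` removes the factors `E_p`, `p ∈ T` (`lamS_planeProd`), hence
`Λ^m (planeProd L m') = m! Σ_T (∏_T c_p⁻¹) planeProd L (m' ∖ T)` (`lam_pow_planeProd`).
-/

namespace Summit.Ventures.HodgeRepro2.A2LamPowers

open WeilPlanes WeilIntegral A2HardLefschetzOps A2PlaneMonomials

section comm

variable {ι : Type*}

/-- Two contractions anticommute (Mathlib's `CliffordAlgebra.contractLeft_comm`). -/
lemma contr_contr (d d' : Module.Dual ℂ (V ι)) (x : A ι) :
    contr d (contr d' x) = -(contr d' (contr d x)) :=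
  CliffordAlgebra.contractLeft_comm d d' x

/-- A contraction is square-zero (Mathlib's `CliffordAlgebra.contractLeft_contractLeft`). -/
lemma contr_contr_self (d : Module.Dual ℂ (V ι)) (x : A ι) : contr d (contr d x) = 0 :=
  CliffordAlgebra.contractLeft_contractLeft d x

/-- **The plane contractions commute pairwise** (each is a product of two anticommuting
contractions, so four sign changes cancel). -/
theorem lamAt_comm (p q : ι) : lamAt p * lamAt q = lamAt q * lamAt p := by
  refine LinearMap.ext fun x => ?_
  simp only [Module.End.mul_apply, lamAt, LinearMap.comp_apply]
  rw [contr_contr (dual (p, false)) (dual (q, true)), map_neg,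
    contr_contr (dual (p, false)) (dual (q, false)), map_neg, map_neg, neg_neg,
    contr_contr (dual (p, true)) (dual (q, true)),
    contr_contr (dual (p, true)) (dual (q, false)), map_neg, neg_neg]

/-- **The plane contractions are square-zero.** -/
theorem lamAt_mul_self (p : ι) : lamAt p * lamAt p = 0 := by
  refine LinearMap.ext fun x => ?_
  simp only [Module.End.mul_apply, lamAt, LinearMap.comp_apply, LinearMap.zero_apply]
  rw [contr_contr (dual (p, false)) (dual (p, true)), map_neg, contr_contr_self, neg_zero]

/-- The set of the plane contractions. -/
def lamSet (ι : Type*) : Set (Module.End ℂ (A ι)) := Set.range (lamAt (ι := ι))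

/-- The commutative subalgebra of `End(A ι)` generated by the plane contractions. -/
def lamAlg (ι : Type*) : Subalgebra ℂ (Module.End ℂ (A ι)) := Algebra.adjoin ℂ (lamSet ι)

/-- The generators of `lamAlg` commute, so it is a commutative subalgebra. -/
instance isMulCommutative_lamAlg : IsMulCommutative (lamAlg ι) :=
  Algebra.isMulCommutative_adjoin ℂ (by
    rintro _ ⟨p, rfl⟩ _ ⟨q, rfl⟩
    exact lamAt_comm p q)

/-- `Λ_p` as an element of the commutative subalgebra `lamAlg`. -/
noncomputable def lamEl (p : ι) : lamAlg ι := ⟨lamAt p, Algebra.subset_adjoin ⟨p, rfl⟩⟩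

/-- `lamEl p` is square-zero in `lamAlg`. -/
lemma lamEl_mul_self (p : ι) : lamEl p * lamEl p = 0 :=
  Subtype.ext (lamAt_mul_self p)

end comm

open scoped IsMulCommutative

variable {ι : Type*}

/-- The product `Λ_T = ∏_{p ∈ T} Λ_p` of the plane contractions of a finite set of planes
(a product in the commutative subalgebra, read back in `End(A ι)`). -/
noncomputable def lamS (T : Finset ι) : Module.End ℂ (A ι) :=
  ((∏ p ∈ T, lamEl p : lamAlg ι) : Module.End ℂ (A ι))

/-- `Λ_∅ = 1`. -/
@[simp] lemma lamS_empty : lamS (∅ : Finset ι) = 1 := by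
  simp [lamS]

/-- `Λ_{insert p T} = Λ_p ∘ Λ_T` for `p ∉ T`. -/
lemma lamS_insert [DecidableEq ι] {p : ι} {T : Finset ι} (hp : p ∉ T) :
    lamS (insert p T) = lamAt p * lamS T := by
  simp only [lamS, Finset.prod_insert hp, Subalgebra.coe_mul]
  rfl

/-- `Λ = Σ_p c_p⁻¹ Λ_p` is the image of the corresponding sum in the commutative subalgebra. -/
lemma lam_eq_val [Fintype ι] (c : ι → ℂ) :
    lam c = (lamAlg ι).val (∑ p, (c p)⁻¹ • lamEl p) := by
  rw [map_sum]
  rfl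

/-- **The multinomial expansion of `Λ^m`**: `Λ^m = m! Σ_{|T| = m} (∏_{p ∈ T} c_p⁻¹) Λ_T`
(p5's `sum_pow_of_sq_eq_zero` in the commutative subalgebra). -/
theorem lam_pow_eq [DecidableEq ι] [Fintype ι] (c : ι → ℂ) (m : ℕ) :
    lam c ^ m = (m.factorial : ℂ) •
      ∑ T ∈ Finset.powersetCard m Finset.univ, (∏ p ∈ T, (c p)⁻¹) • lamS T := by
  have hsq : ∀ p ∈ (Finset.univ : Finset ι), ((c p)⁻¹ • lamEl p) ^ 2 = 0 := by
    intro p _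
    rw [smul_pow, pow_two (lamEl p), lamEl_mul_self, smul_zero]
  have key := WeilPlanes.sum_pow_of_sq_eq_zero Finset.univ (fun p => (c p)⁻¹ • lamEl p) hsq m
  rw [lam_eq_val, ← map_pow, key, map_mul, map_natCast, map_sum, ← nsmul_eq_mul,
    ← Nat.cast_smul_eq_nsmul ℂ]
  congr 1
  refine Finset.sum_congr rfl fun T _ => ?_
  rw [Finset.prod_smul, map_smul]
  rfl

/-- **`Λ_T` on a plane-sorted monomial**: it removes the factors `E_p`, `p ∈ T`, and kills the
monomial if some plane of `T` is absent or carries a factor other than `E_p`. -/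
theorem lamS_planeProd [DecidableEq ι] {L : List ι} (hL : L.Nodup) (T : Finset ι)
    (m : ι → Bool × Bool) :
    lamS T (planeProd L m) =
      if ∀ p ∈ T, p ∈ L ∧ m p = (true, true) then planeProd L (eraseS m T) else 0 := by
  induction T using Finset.induction_on with
  | empty => simp
  | insert p T hp ih =>
    rw [lamS_insert hp, Module.End.mul_apply, ih]
    by_cases hT : ∀ q ∈ T, q ∈ L ∧ m q = (true, true)
    · rw [if_pos hT, lamAt_planeProd hL, eraseS_apply_of_notMem m hp]
      by_cases hpL : p ∈ L ∧ m p = (true, true)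
      · rw [if_pos hpL, if_pos, eraseS_insert]
        intro q hq
        rcases Finset.mem_insert.1 hq with rfl | hq
        · exact hpL
        · exact hT q hq
      · rw [if_neg hpL, if_neg]
        intro h
        exact hpL (h p (Finset.mem_insert_self p T))
    · rw [if_neg hT, map_zero, if_neg]
      intro h
      exact hT fun q hq => h q (Finset.mem_insert_of_mem hq)

/-- **`Λ^k` on a plane-sorted monomial**: `k! Σ_{|T| = k} (∏_{p ∈ T} c_p⁻¹) · planeProd L (m ∖ T)`,
the sum running over the sets `T` of planes of `L` carrying the factor `E_p`. -/
theorem lam_pow_planeProd [DecidableEq ι] [Fintype ι] (c : ι → ℂ) (k : ℕ) {L : List ι}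
    (hL : L.Nodup) (m : ι → Bool × Bool) :
    (lam c ^ k) (planeProd L m) = (k.factorial : ℂ) •
      ∑ T ∈ Finset.powersetCard k Finset.univ,
        if ∀ p ∈ T, p ∈ L ∧ m p = (true, true) then
          (∏ p ∈ T, (c p)⁻¹) • planeProd L (eraseS m T) else 0 := by
  rw [lam_pow_eq, LinearMap.smul_apply, LinearMap.sum_apply]
  congr 1
  refine Finset.sum_congr rfl fun T _ => ?_
  rw [LinearMap.smul_apply, lamS_planeProd hL]
  split_ifs <;> simp

end Summit.Ventures.HodgeRepro2.A2LamPowers
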